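import Mathlib
import HarnessLib
import Literature.Analysis.Calculus.FunctionalDependence
import Summits.NavierStokesRegularity.NavierStokesRegularity.Theorems.PoloidalWindowDoorPoloidalWindowRigidityConstantShearMeans
import Summits.NavierStokesRegularity.NavierStokesRegularity.Theorems.PoloidalWindowDoorPoloidalWindowRigidityKillingOpenSet

/-!
# Route `PoloidalWindowDoor`, item `LrcModEntire` (stmt-NavierStokesRegularity-20428) — AXIS KINEMATICS I: a rotation germ of a scalar
# about a vertical axis means «locally a function of (ρ², x₂)»

Cell ns-regularity-ideate, seat ns-poloidal-K2-p3 gen 5 (LEAD of item 20428; file landed `--supports stmt-NavierStokesRegularity-20428` as a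
helper).  First kernel brick of this seat's AXIS-NOTE (evidence on 20428/19708: the «common vertical axis» step of the structural END is kinematic
in the class).  Its step 1 reads a rotation germ `Df(y)[J(y − c)] = 0` (the format produced by the K2 lead's planar Levi-Civita–Segre files and
consumed by this seat's `…LrcModEntireStreamSymmetryGerm`) as «`f` is a function of `ρ² = |y_h − c_h|²` and of the height» near any point off
the axis — an instance of the functional dependence theorem `Literature.Analysis.Calculus.exists_comp_slice` (p530343) with `g = ρ²`, because
`Df(y)[J(y − c)] = (y₀ − c₀) ∂₁f − (y₁ − c₁) ∂₀f = −½ {f, ρ²}_h`.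

* `fderiv_rotGen_sub_eq` — the rotational derivative in coordinates: `Df(y)[J(y − c)] = (y₀ − c₀)·Df(y)e₁ − (y₁ − c₁)·Df(y)e₀`;
* `fderiv_sqDist` — `D(ρ²)(y) e_b = 2 (y_b − c_b)` for horizontal `b`, `D(ρ²)(y) e₂ = 0`, where `ρ²(y) = (y₀ − c₀)² + (y₁ − c₁)²`;
* `bracket_sqDist_eq` — `Df e₀ · D(ρ²) e₁ − Df e₁ · D(ρ²) e₀ = −2 · Df(y)[J(y − c)]`;
* `exists_radial_of_rotGerm` — **`f` of class `Cⁿ` at `y₀` (`n ≠ 0`), `Df(y)[J(y − c)] = 0` for `y` near `y₀`, `y₀` off the axis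
  (`(y₀)₀ ≠ c₀ ∨ (y₀)₁ ≠ c₁`) ⇒ `∃ P : ℝ × ℝ → ℝ`, `Cⁿ` at `(ρ²(y₀), (y₀)₂)`, with `f y = P (ρ²(y), y₂)` for all `y` near `y₀`.**

WHAT THIS IS NOT: not a claim about Navier–Stokes regularity and not the axis lemma itself (steps 2–5 of AXIS-NOTE are the successor's) —
kinematic bookkeeping (bears_on LADDER-NS N0 via item 20428).
-/

noncomputable section

-- the summit and its single sub-problem share the name (CONVENTIONS §1), as in every Theorems file
set_option linter.dupNamespace false

namespace Summit.NavierStokesRegularity.NavierStokesRegularity.Theorems.PoloidalWindowDoorLrcModEntireAxisKinematics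

open Set Function Filter Topology Metric
open scoped RealInnerProductSpace InnerProductSpace
open Literature.Analysis Literature.Analysis.FluidPDE Literature.Analysis.Calculus
open Summit.NavierStokesRegularity.NavierStokesRegularity.Theorems.PoloidalWindowDoorPoloidalWindowRigidityConstantShearMeans

/-! ### The rotational derivative in coordinates -/

/-- `J(y − c) = −(y₁ − c₁) e₀ + (y₀ − c₀) e₁`. -/
theorem rotGen_sub_eq (y c : EuclideanSpace ℝ (Fin 3)) :
    rotGen (y - c) = (-(y 1 - c 1)) • EuclideanSpace.single 0 (1 : ℝ) + (y 0 - c 0) • EuclideanSpace.single 1 (1 : ℝ) := by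
  ext i
  fin_cases i <;> simp [rotGen]

/-- **The rotational derivative in coordinates**: `Df(y)[J(y − c)] = (y₀ − c₀) Df(y) e₁ − (y₁ − c₁) Df(y) e₀`. -/
theorem fderiv_rotGen_sub_eq (f : EuclideanSpace ℝ (Fin 3) → ℝ) (y c : EuclideanSpace ℝ (Fin 3)) :
    fderiv ℝ f y (rotGen (y - c)) =
      (y 0 - c 0) * fderiv ℝ f y (EuclideanSpace.single 1 1) - (y 1 - c 1) * fderiv ℝ f y (EuclideanSpace.single 0 1) := by
  rw [rotGen_sub_eq, map_add, map_smul, map_smul, smul_eq_mul, smul_eq_mul]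
  ring

/-! ### The squared distance to the axis -/

/-- The squared horizontal distance to the vertical axis through `c`: `ρ²(y) = (y₀ − c₀)² + (y₁ − c₁)²`. -/
theorem contDiff_sqDist (c : EuclideanSpace ℝ (Fin 3)) {n : WithTop ℕ∞} :
    ContDiff ℝ n (fun y : EuclideanSpace ℝ (Fin 3) => (y 0 - c 0) ^ 2 + (y 1 - c 1) ^ 2) := by
  have h0 : ContDiff ℝ n (fun y : EuclideanSpace ℝ (Fin 3) => y 0) :=
    (EuclideanSpace.proj (0 : Fin 3) : EuclideanSpace ℝ (Fin 3) →L[ℝ] ℝ).contDiff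
  have h1 : ContDiff ℝ n (fun y : EuclideanSpace ℝ (Fin 3) => y 1) :=
    (EuclideanSpace.proj (1 : Fin 3) : EuclideanSpace ℝ (Fin 3) →L[ℝ] ℝ).contDiff
  exact ((h0.sub contDiff_const).pow 2).add ((h1.sub contDiff_const).pow 2)

/-- The derivative of `ρ²`: `D(ρ²)(y) w = 2 (y₀ − c₀) w₀ + 2 (y₁ − c₁) w₁`. -/
theorem hasFDerivAt_sqDist (c y : EuclideanSpace ℝ (Fin 3)) :
    HasFDerivAt (fun y : EuclideanSpace ℝ (Fin 3) => (y 0 - c 0) ^ 2 + (y 1 - c 1) ^ 2)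
      ((2 * (y 0 - c 0)) • (EuclideanSpace.proj (0 : Fin 3) : EuclideanSpace ℝ (Fin 3) →L[ℝ] ℝ) +
        (2 * (y 1 - c 1)) • (EuclideanSpace.proj (1 : Fin 3) : EuclideanSpace ℝ (Fin 3) →L[ℝ] ℝ)) y := by
  have h0 : HasFDerivAt (fun y : EuclideanSpace ℝ (Fin 3) => y 0 - c 0)
      (EuclideanSpace.proj (0 : Fin 3) : EuclideanSpace ℝ (Fin 3) →L[ℝ] ℝ) y :=
    (EuclideanSpace.proj (0 : Fin 3) : EuclideanSpace ℝ (Fin 3) →L[ℝ] ℝ).hasFDerivAt.sub_const _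
  have h1 : HasFDerivAt (fun y : EuclideanSpace ℝ (Fin 3) => y 1 - c 1)
      (EuclideanSpace.proj (1 : Fin 3) : EuclideanSpace ℝ (Fin 3) →L[ℝ] ℝ) y :=
    (EuclideanSpace.proj (1 : Fin 3) : EuclideanSpace ℝ (Fin 3) →L[ℝ] ℝ).hasFDerivAt.sub_const _
  have h := (h0.pow 2).add (h1.pow 2)
  refine h.congr_fderiv ?_
  ext w
  simp

/-- `D(ρ²)(y) e_b` for the three coordinate directions: `2(y₀ − c₀)`, `2(y₁ − c₁)`, `0`. -/
theorem fderiv_sqDist (c y : EuclideanSpace ℝ (Fin 3)) :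
    fderiv ℝ (fun y : EuclideanSpace ℝ (Fin 3) => (y 0 - c 0) ^ 2 + (y 1 - c 1) ^ 2) y (EuclideanSpace.single 0 1) =
        2 * (y 0 - c 0) ∧
      fderiv ℝ (fun y : EuclideanSpace ℝ (Fin 3) => (y 0 - c 0) ^ 2 + (y 1 - c 1) ^ 2) y (EuclideanSpace.single 1 1) =
        2 * (y 1 - c 1) ∧
      fderiv ℝ (fun y : EuclideanSpace ℝ (Fin 3) => (y 0 - c 0) ^ 2 + (y 1 - c 1) ^ 2) y (EuclideanSpace.single 2 1) = 0 := by
  rw [(hasFDerivAt_sqDist c y).fderiv]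
  refine ⟨?_, ?_, ?_⟩ <;> simp

/-- **The rotational derivative is `−½` the bracket with `ρ²`**:
`Df e₀ · D(ρ²) e₁ − Df e₁ · D(ρ²) e₀ = −2 · Df(y)[J(y − c)]`. -/
theorem bracket_sqDist_eq (f : EuclideanSpace ℝ (Fin 3) → ℝ) (c y : EuclideanSpace ℝ (Fin 3)) :
    fderiv ℝ f y (EuclideanSpace.single 0 1) *
          fderiv ℝ (fun y : EuclideanSpace ℝ (Fin 3) => (y 0 - c 0) ^ 2 + (y 1 - c 1) ^ 2) y (EuclideanSpace.single 1 1) -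
        fderiv ℝ f y (EuclideanSpace.single 1 1) *
          fderiv ℝ (fun y : EuclideanSpace ℝ (Fin 3) => (y 0 - c 0) ^ 2 + (y 1 - c 1) ^ 2) y (EuclideanSpace.single 0 1) =
      -2 * fderiv ℝ f y (rotGen (y - c)) := by
  obtain ⟨h0, h1, -⟩ := fderiv_sqDist c y
  rw [h0, h1, fderiv_rotGen_sub_eq]
  ring

/-! ### A rotation germ is locally a function of `(ρ², x₂)` -/

/-- **Rotation germ ⇒ locally radial.**  Let `f : ℝ³ → ℝ` be `Cⁿ` at `y₀` (`n ≠ 0`), with `Df(y)[J(y − c)] = 0` for all `y` near `y₀`, and let `y₀`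
lie off the vertical axis through `c` (`(y₀)₀ ≠ c₀ ∨ (y₀)₁ ≠ c₁`).  Then there is `P : ℝ × ℝ → ℝ`, of class `Cⁿ` at `(ρ²(y₀), (y₀)₂)`, with
`f y = P ((y₀−c₀)²+(y₁−c₁)², y₂)` (evaluated at `y`) for all `y` near `y₀` — `f` is, near `y₀`, a function of the squared distance to the axis and
of the height (the functional dependence theorem `exists_comp_slice` with `g = ρ²`, whose horizontal bracket with `f` is `−2 Df[J(y−c)] = 0`). -/
theorem exists_radial_of_rotGerm {n : WithTop ℕ∞} (hn : n ≠ 0) {f : EuclideanSpace ℝ (Fin 3) → ℝ}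
    {y₀ c : EuclideanSpace ℝ (Fin 3)} (hf : ContDiffAt ℝ n f y₀)
    (hrot : ∀ᶠ y in 𝓝 y₀, fderiv ℝ f y (rotGen (y - c)) = 0) (hoff : y₀ 0 ≠ c 0 ∨ y₀ 1 ≠ c 1) :
    ∃ P : ℝ × ℝ → ℝ, ContDiffAt ℝ n P ((y₀ 0 - c 0) ^ 2 + (y₀ 1 - c 1) ^ 2, y₀ 2) ∧
      ∀ᶠ y in 𝓝 y₀, f y = P ((y 0 - c 0) ^ 2 + (y 1 - c 1) ^ 2, y 2) := by
  set g : EuclideanSpace ℝ (Fin 3) → ℝ := fun y => (y 0 - c 0) ^ 2 + (y 1 - c 1) ^ 2 with hg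
  have hgc : ContDiffAt ℝ n g y₀ := (contDiff_sqDist c).contDiffAt
  -- the bracket `{f, g}_h` vanishes near `y₀`
  have hbr01 : ∀ᶠ y in 𝓝 y₀,
      fderiv ℝ f y (EuclideanSpace.single 0 1) * fderiv ℝ g y (EuclideanSpace.single 1 1) =
        fderiv ℝ f y (EuclideanSpace.single 1 1) * fderiv ℝ g y (EuclideanSpace.single 0 1) := by
    filter_upwards [hrot] with y hy
    have h := bracket_sqDist_eq f c y
    rw [hy, mul_zero] at h
    linarith
  rcases hoff with h0 | h1
  · -- pin on the index `0`: `∂₀ g (y₀) = 2 (y₀₀ − c₀) ≠ 0`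
    have hpin : fderiv ℝ g y₀ (EuclideanSpace.single 0 1) ≠ 0 := by
      rw [(fderiv_sqDist c y₀).1]
      exact mul_ne_zero two_ne_zero (sub_ne_zero.2 h0)
    exact exists_comp_slice hn (b₀ := 0) (b₁ := 1) (by decide) (by decide) (by decide) hf hgc hpin hbr01
  · have hpin : fderiv ℝ g y₀ (EuclideanSpace.single 1 1) ≠ 0 := by
      rw [(fderiv_sqDist c y₀).2.1]
      exact mul_ne_zero two_ne_zero (sub_ne_zero.2 h1)
    have hbr10 : ∀ᶠ y in 𝓝 y₀,
        fderiv ℝ f y (EuclideanSpace.single 1 1) * fderiv ℝ g y (EuclideanSpace.single 0 1) =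
          fderiv ℝ f y (EuclideanSpace.single 0 1) * fderiv ℝ g y (EuclideanSpace.single 1 1) :=
      hbr01.mono fun y hy => hy.symm
    exact exists_comp_slice hn (b₀ := 1) (b₁ := 0) (by decide) (by decide) (by decide) hf hgc hpin hbr10

end Summit.NavierStokesRegularity.NavierStokesRegularity.Theorems.PoloidalWindowDoorLrcModEntireAxisKinematics

end
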